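import Summits.AtomisticToContinuum.Crystallization.Theorems.PerronTransitivityUniformBindingRigidityCohesionI

/-!
# Cohesion of uniformly bound Lennard-Jones configurations, XI: the separation bootstrap `(SEP)`

Helper file (`--supports stmt-AtomisticToContinuum-15099`) proving the registered stub
`stub_sepBootstrap` (= `(SEP)`) of the line `registered` of the crux
`Summit.AtomisticToContinuum.Crystallization.Theses.PerronTransitivity.UniformBindingRigidity`
(item stmt-AtomisticToContinuum-15099).  In the notation
`U_Y(p) = Σ'_{q ∈ Y, q ≠ p} V_LJ(dist p q)`, `V_LJ(r) = r⁻¹²/12 − r⁻⁶/6`: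

  a `1/4`-separated `Y ⊆ ℝ³` all of whose site sums are `≤ −711/500` is `9/20`-separated.

The proof is the infimum-of-distances bootstrap of part I (`quarter_le_dist`) with the sharper
single-site bookkeeping of part IX: with `m = inf` of the mutual distances (`1/4 ≤ m < 9/20` if some
pair is closer than `9/20`), `Y` is `m`-separated, and at a pair `a ≠ b` with
`dist a b < 2^{1/12} m` the truncation of `U_Y(a)` at radius `5/2` (`sum_near_sub_tail_le_tsum`,
`card_near_le`, `neg_card_div_le_sum_lennardJones`) gives
`U_Y(a) > 1/(24 m¹²) − m⁻⁶/6 − ((5/m + 1)³ − 2)/12 − (1/6)·1024/((5/2)³ m³) > −711/500`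
(`sepBootstrap_numerics`, two interval cases `[1/4, 2/5]`, `[2/5, 9/20]`, each term bounded at the
unfavourable endpoint).  All `[folklore]`.
-/

noncomputable section

namespace Summit.AtomisticToContinuum.Crystallization.Theorems.PerronTransitivityUniformBindingRigidity

open scoped BigOperators Topology
open Filter Set Metric
open Literature.MathematicalPhysics.StatisticalMechanics
open Summit.AtomisticToContinuum.Crystallization.Theorems.ChargedEnergyGapNegative (E3)

/-! ## §20 The numerical inequality -/

/-- **Numerics of the bootstrap.** For `1/4 ≤ m ≤ 9/20`:
`m⁻⁶/6 + ((5/m + 1)³ − 2)/12 + (1/6)·1024/(m³ (5/2)³) − 711/500 < (1/12)(2 m¹²)⁻¹`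
(two cases `m ≤ 2/5`, `2/5 ≤ m`; every term is monotone in `m` and is bounded at the unfavourable
endpoint of its interval, leaving a margin `> 180`). [folklore] -/
theorem sepBootstrap_numerics {m : ℝ} (h1 : 1 / 4 ≤ m) (h2 : m ≤ 9 / 20) :
    1 / 6 * m⁻¹ ^ 6 + 1 / 12 * ((2 * (5 / 2) / m + 1) ^ 3 - 2) +
        1 / 6 * (1024 / (m ^ 3 * (5 / 2) ^ 3)) - 711 / 500 < 1 / 12 * (2 * m ^ 12)⁻¹ := by
  have hm0 : 0 < m := by linarith
  rcases le_total m (2 / 5) with h | h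
  · -- `1/4 ≤ m ≤ 2/5`
    have hA : (244140625 / 98304 : ℝ) ≤ 1 / 12 * (2 * m ^ 12)⁻¹ := by
      rw [show (244140625 / 98304 : ℝ) = 1 / 12 * (2 * (2 / 5 : ℝ) ^ 12)⁻¹ by norm_num]
      gcongr
    have hB : 1 / 6 * m⁻¹ ^ 6 ≤ 2048 / 3 := by
      rw [show (2048 / 3 : ℝ) = 1 / 6 * (1 / 4 : ℝ)⁻¹ ^ 6 by norm_num]
      gcongr
    have hC : (2 * (5 / 2) / m + 1) ^ 3 ≤ 9261 := by
      rw [show (9261 : ℝ) = (2 * (5 / 2) / (1 / 4 : ℝ) + 1) ^ 3 by norm_num]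
      gcongr
    have hD : 1024 / (m ^ 3 * (5 / 2) ^ 3) ≤ 524288 / 125 := by
      rw [show (524288 / 125 : ℝ) = 1024 / ((1 / 4 : ℝ) ^ 3 * (5 / 2) ^ 3) by norm_num]
      gcongr
    linarith
  · -- `2/5 ≤ m ≤ 9/20`
    have hA : (1 : ℝ) / 12 * (2 * (9 / 20 : ℝ) ^ 12)⁻¹ ≤ 1 / 12 * (2 * m ^ 12)⁻¹ := by
      gcongr
    have hA' : (604 : ℝ) ≤ 1 / 12 * (2 * (9 / 20 : ℝ) ^ 12)⁻¹ := by norm_num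
    have hB : 1 / 6 * m⁻¹ ^ 6 ≤ 15625 / 384 := by
      rw [show (15625 / 384 : ℝ) = 1 / 6 * (2 / 5 : ℝ)⁻¹ ^ 6 by norm_num]
      gcongr
    have hC : (2 * (5 / 2) / m + 1) ^ 3 ≤ 19683 / 8 := by
      rw [show (19683 / 8 : ℝ) = (2 * (5 / 2) / (2 / 5 : ℝ) + 1) ^ 3 by norm_num]
      gcongr
    have hD : 1024 / (m ^ 3 * (5 / 2) ^ 3) ≤ 1024 := by
      calc 1024 / (m ^ 3 * (5 / 2) ^ 3) ≤ 1024 / ((2 / 5 : ℝ) ^ 3 * (5 / 2) ^ 3) := by gcongr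
        _ = 1024 := by norm_num
    linarith

/-! ## §21 The separation bootstrap -/

/-- **Registered stub `stub_sepBootstrap` `(SEP)`** (stmt-AtomisticToContinuum-15099): a
`1/4`-separated `Y ⊆ ℝ³` all of whose Lennard-Jones site sums are `≤ −711/500` is `9/20`-separated.
With `m = inf` of the mutual distances (`≥ 1/4`, and `< 9/20` if the conclusion failed), `Y` is
`m`-separated; at a pair `a ≠ b` with `dist a b < 2^{1/12} m` (so `(dist a b)⁻¹² > (2m¹²)⁻¹`,
`(dist a b)⁻⁶ ≤ m⁻⁶`, `dist a b ≤ 5/2`) truncate `U_Y(a)` at radius `5/2`: the near sum is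
`V_LJ(dist a b)` plus at least `−(#F − 1)/12`, `#F ≤ (5/m + 1)³ − 1`, the tail is
`≥ −(1/6)·1024/(m³ (5/2)³)`, and `sepBootstrap_numerics` contradicts `U_Y(a) ≤ −711/500`.
[folklore] -/
theorem stub_sepBootstrap :
    ∀ Y : Set (EuclideanSpace ℝ (Fin 3)),
      (∀ p ∈ Y, ∀ q ∈ Y, p ≠ q → 1 / 4 ≤ dist p q) →
      (∀ p ∈ Y, ∑' q : {q : EuclideanSpace ℝ (Fin 3) // q ∈ Y ∧ q ≠ p},
          lennardJones (dist p q.1) ≤ -(711 / 500)) →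
      ∀ p ∈ Y, ∀ q ∈ Y, p ≠ q → 9 / 20 ≤ dist p q := by
  classical
  intro Y hsep hU
  by_contra hcon
  push Not at hcon
  obtain ⟨p₀, hp₀, q₀, hq₀, hne₀, hlt₀⟩ := hcon
  -- the infimum `m` of the mutual distances
  set S : Set ℝ := {r | ∃ a ∈ Y, ∃ b ∈ Y, a ≠ b ∧ r = dist a b} with hS
  have hSne : S.Nonempty := ⟨dist p₀ q₀, p₀, hp₀, q₀, hq₀, hne₀, rfl⟩
  have hSbdd : BddBelow S :=
    ⟨1 / 4, by rintro r ⟨a, ha, b, hb, hab, rfl⟩; exact hsep a ha b hb hab⟩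
  set m : ℝ := sInf S with hm
  have h4m : 1 / 4 ≤ m :=
    le_csInf hSne (by rintro r ⟨a, ha, b, hb, hab, rfl⟩; exact hsep a ha b hb hab)
  have hm0 : 0 < m := by linarith
  have hmsep : ∀ a ∈ Y, ∀ b ∈ Y, a ≠ b → m ≤ dist a b := fun a ha b hb hab =>
    csInf_le hSbdd ⟨a, ha, b, hb, hab, rfl⟩
  have hm9 : m < 9 / 20 := (csInf_le hSbdd ⟨p₀, hp₀, q₀, hq₀, hne₀, rfl⟩).trans_lt hlt₀
  -- a pair at distance `< 2^{1/12} m`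
  set c : ℝ := (2 : ℝ) ^ ((1 : ℝ) / 12) with hc
  have hc1 : 1 < c := Real.one_lt_rpow (by norm_num) (by norm_num)
  have hc12 : c ^ 12 = 2 := by
    rw [show (c ^ 12 : ℝ) = c ^ ((12 : ℕ) : ℝ) from (Real.rpow_natCast c 12).symm, hc,
      ← Real.rpow_mul (by norm_num : (0 : ℝ) ≤ 2)]
    norm_num
  have hmc : m < m * c := lt_mul_right hm0 hc1
  obtain ⟨r, ⟨a, ha, b, hb, hab, rfl⟩, hr⟩ := exists_lt_of_csInf_lt hSne (hm ▸ hmc)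
  -- the distinguished distance `dist a b`
  have hdm : m ≤ dist a b := hmsep a ha b hb hab
  have hd0 : 0 < dist a b := hm0.trans_le hdm
  have hd12 : (dist a b) ^ 12 < 2 * m ^ 12 := by
    calc (dist a b) ^ 12 < (m * c) ^ 12 := pow_lt_pow_left₀ hr dist_nonneg (by norm_num)
      _ = 2 * m ^ 12 := by rw [mul_pow, hc12]; ring
  have hinv12 : (2 * m ^ 12)⁻¹ < (dist a b)⁻¹ ^ 12 := by
    rw [inv_pow]
    exact (inv_lt_inv₀ (by positivity) (by positivity)).2 hd12
  have hinv6 : (dist a b)⁻¹ ^ 6 ≤ m⁻¹ ^ 6 := by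
    gcongr
  have hd52 : dist a b ≤ 5 / 2 := by
    by_contra h
    push Not at h
    have h1 : (5 / 2 : ℝ) ^ 12 ≤ (dist a b) ^ 12 := pow_le_pow_left₀ (by norm_num) h.le 12
    have h2 : m ^ 12 ≤ (9 / 20 : ℝ) ^ 12 := pow_le_pow_left₀ hm0.le hm9.le 12
    norm_num at h1 h2
    linarith
  -- truncation of the site sum at `a` at radius `5/2`
  obtain ⟨F, hF⟩ := exists_finset_near hm0 hmsep a (5 / 2 : ℝ)
  have hR : m ≤ 5 / 2 := by linarith
  have hlow := sum_near_sub_tail_le_tsum hm0 hmsep a hR F hF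
  have hcard := card_near_le hm0 hmsep ha (by norm_num : (0 : ℝ) ≤ 5 / 2) F hF
  have hbF : b ∈ F := (hF b).2 ⟨hb, Ne.symm hab, by rw [dist_comm]; exact hd52⟩
  have hsplit : ∑ q ∈ F, lennardJones (dist a q) =
      lennardJones (dist a b) + ∑ q ∈ F.erase b, lennardJones (dist a q) :=
    (Finset.add_sum_erase F (fun q => lennardJones (dist a q)) hbF).symm
  have hrest := neg_card_div_le_sum_lennardJones (F.erase b) fun q => dist a q
  have hcardE : ((F.erase b).card : ℝ) + 1 = F.card := by
    exact_mod_cast Finset.card_erase_add_one hbF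
  have hV : lennardJones (dist a b) =
      1 / 12 * (dist a b)⁻¹ ^ 12 - 1 / 6 * (dist a b)⁻¹ ^ 6 := rfl
  have hnum := sepBootstrap_numerics h4m hm9.le
  have hUa := hU a ha
  rw [hsplit, hV] at hlow
  linarith

end Summit.AtomisticToContinuum.Crystallization.Theorems.PerronTransitivityUniformBindingRigidity

end
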